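import Summits.AnomalousDissipation.AnomalousDissipation.Theorems.SawtoothPulseCascadeK1LocalisedCascadeKHModePairedCreation

/-!
# K2 lane (route-2 `SawtoothPulseCascade`, crux dir `K1LocalisedCascade`): the THRESHOLD-FREE Duhamel bound (any line, stable or not)

Helper file of the K2 lane (ACL item stmt-AnomalousDissipation-19491; memo `K2BookReduction-p2.md` §26–§28, B1 of record `CoreLineLaw` on the unit strip
`|a| < 1`).  The stable-row Duhamel bounds of `…KHModeCreation` (`norm_duhamel_env_le`) divide by the oscillation rate `ω`, which vanishes at the
Kelvin–Helmholtz threshold and does not exist in the unstable band.  Here the propagator entries are two ARBITRARY real functions `C`, `Sn` with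
`|C| ≤ Mc`, `|Sn| ≤ Ms` on `[0, θ]` (for the 2×2 block with `X² = λ·1`: `Mc = cosh(θ√λ₊)`, `Ms = θ·cosh(θ√λ₊)`, `λ₊ = max 0 λ` —
`abs_sin_div_le`, `sinh_div_le_mul_cosh` below), and the created amplitude is at most `(Mc‖c₀‖ + Ms(‖x₀‖‖c₀‖ + ‖x₁‖‖c₁‖))·∫₀^θ env`
for any continuous pointwise envelope of the two sources (`norm_duhamel_CSn_le`); with the paired envelope of `…KHModePairedSourceNeg` the integral is the
`arctan` window of `…KHModePairedCreation`.  No definitions; no statement about the crux. [folklore] [problem: turb]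
-/

-- `Summit.<Summit>.<Problem>`: single-conjunct summit, the duplicate namespace segment is deliberate.
set_option linter.dupNamespace false

noncomputable section

namespace Summit.AnomalousDissipation.AnomalousDissipation.Theorems.SawtoothPulseCascade.K2PhaseBudget

open Set MeasureTheory intervalIntegral Literature.Analysis.FluidPDE.SawtoothCascade

/-! ## §1 Elementary bounds for the three propagator branches -/

/-- `|sin(ωt)/ω| ≤ t` for `t ≥ 0`, `ω ≠ 0`. [folklore] -/
theorem abs_sin_div_le {ω t : ℝ} (hω : ω ≠ 0) (ht : 0 ≤ t) : |Real.sin (ω * t) / ω| ≤ t := by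
  rw [abs_div, div_le_iff₀ (abs_pos.2 hω)]
  calc |Real.sin (ω * t)| ≤ |ω * t| := Real.abs_sin_le_abs
    _ = t * |ω| := by rw [abs_mul, abs_of_nonneg ht, mul_comm]

/-- `sinh(ωt)/ω ≤ t·cosh(ωt)` for `t ≥ 0`, `ω > 0` (inside: `sinh y ≤ y cosh y`, `d/dy (y cosh y − sinh y) = y sinh y ≥ 0` — the tree has this
as `BraidExit.sinh_le_mul_cosh` in a module not imported here). [folklore] -/
theorem sinh_div_le_mul_cosh {ω t : ℝ} (hω : 0 < ω) (ht : 0 ≤ t) :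
    |Real.sinh (ω * t) / ω| ≤ t * Real.cosh (ω * t) := by
  have hy : 0 ≤ ω * t := mul_nonneg hω.le ht
  have hs0 : 0 ≤ Real.sinh (ω * t) := Real.sinh_nonneg_iff.2 hy
  -- `sinh y ≤ y cosh y` for `y = ω t ≥ 0`
  have hderiv : ∀ x : ℝ, HasDerivAt (fun x : ℝ => x * Real.cosh x - Real.sinh x) (x * Real.sinh x) x := by
    intro x
    have h1 : HasDerivAt (fun x : ℝ => x * Real.cosh x) (1 * Real.cosh x + x * Real.sinh x) x :=
      (hasDerivAt_id x).mul (Real.hasDerivAt_cosh x)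
    have h2 := Real.hasDerivAt_sinh x
    have h3 := h1.sub h2
    simp only [one_mul, add_sub_cancel_left] at h3
    exact h3
  have hmono : MonotoneOn (fun x : ℝ => x * Real.cosh x - Real.sinh x) (Set.Ici 0) := by
    refine monotoneOn_of_deriv_nonneg (convex_Ici 0) (fun x _ => (hderiv x).continuousAt.continuousWithinAt)
      (fun x _ => (hderiv x).differentiableAt.differentiableWithinAt) fun x hx => ?_
    rw [interior_Ici] at hx
    rw [(hderiv x).deriv]
    exact mul_nonneg (le_of_lt hx) (Real.sinh_nonneg_iff.2 (le_of_lt hx))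
  have hm := hmono (Set.mem_Ici.2 (le_refl (0 : ℝ))) (Set.mem_Ici.2 hy) hy
  simp only [zero_mul, Real.sinh_zero, sub_zero] at hm
  have h : Real.sinh (ω * t) ≤ ω * t * Real.cosh (ω * t) := by linarith
  rw [abs_of_nonneg (div_nonneg hs0 hω.le), div_le_iff₀ hω]
  nlinarith [Real.cosh_pos (ω * t)]

/-- `|cos x| ≤ cosh y` for all `x, y`. [folklore] -/
theorem abs_cos_le_cosh (x y : ℝ) : |Real.cos x| ≤ Real.cosh y := (Real.abs_cos_le_one x).trans (Real.one_le_cosh y)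

/-- Monotonicity used for the uniform bound on `[0, θ]`: `cosh(ωt) ≤ cosh(ωθ)` for `0 ≤ t ≤ θ`, `0 ≤ ω`. [folklore] -/
theorem cosh_mul_le_cosh_mul {ω t θ : ℝ} (hω : 0 ≤ ω) (ht : 0 ≤ t) (htθ : t ≤ θ) : Real.cosh (ω * t) ≤ Real.cosh (ω * θ) := by
  rw [Real.cosh_le_cosh, abs_of_nonneg (mul_nonneg hω ht), abs_of_nonneg (mul_nonneg hω (ht.trans htθ))]
  exact mul_le_mul_of_nonneg_left htθ hω

/-! ## §2 The threshold-free Duhamel bound -/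

/-- Pointwise: `‖C·(c₀S₀) + Sn·(x₀c₀S₀ + x₁c₁S₁)‖ ≤ |C|‖c₀‖‖S₀‖ + |Sn|(‖x₀‖‖c₀‖‖S₀‖ + ‖x₁‖‖c₁‖‖S₁‖)`. [folklore] -/
theorem norm_duhamel_integrand_CSn_le (C Sn : ℝ) (x₀ x₁ c₀ c₁ S₀ S₁ : ℂ) :
    ‖(C : ℂ) * (c₀ * S₀) + (Sn : ℂ) * (x₀ * (c₀ * S₀) + x₁ * (c₁ * S₁))‖ ≤
      |C| * (‖c₀‖ * ‖S₀‖) + |Sn| * (‖x₀‖ * (‖c₀‖ * ‖S₀‖) + ‖x₁‖ * (‖c₁‖ * ‖S₁‖)) := by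
  refine (norm_add_le _ _).trans ?_
  rw [norm_mul, Complex.norm_real, Real.norm_eq_abs, norm_mul, norm_mul, Complex.norm_real, Real.norm_eq_abs]
  refine add_le_add le_rfl (mul_le_mul_of_nonneg_left ((norm_add_le _ _).trans (le_of_eq ?_)) (abs_nonneg _))
  simp only [norm_mul]

/-- **THE THRESHOLD-FREE DUHAMEL BOUND (main term first).** Any real propagator entries `C`, `Sn` with `|C| ≤ Mc`, `|Sn| ≤ Ms` on `[0, θ]`, sources under a
continuous common envelope: the created amplitude is `≤ (Mc‖c₀‖ + Ms(‖x₀‖‖c₀‖ + ‖x₁‖‖c₁‖))·∫₀^θ env`.  No stability, no rate. [folklore] -/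
theorem norm_duhamel_CSn_le {θ Mc Ms : ℝ} {C Sn : ℝ → ℝ} {x₀ x₁ c₀ c₁ : ℂ} {S₀ S₁ : ℝ → ℂ} {env : ℝ → ℝ} (hθ : 0 ≤ θ)
    (hC : ∀ t ∈ Set.Icc (0 : ℝ) θ, |C t| ≤ Mc) (hSn : ∀ t ∈ Set.Icc (0 : ℝ) θ, |Sn t| ≤ Ms)
    (henv : Continuous env) (hE₀ : ∀ s, ‖S₀ s‖ ≤ env s) (hE₁ : ∀ s, ‖S₁ s‖ ≤ env s) :
    ‖∫ s in (0 : ℝ)..θ, ((C (θ - s) : ℝ) : ℂ) * (c₀ * S₀ s) + ((Sn (θ - s) : ℝ) : ℂ) * (x₀ * (c₀ * S₀ s) + x₁ * (c₁ * S₁ s))‖ ≤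
      (Mc * ‖c₀‖ + Ms * (‖x₀‖ * ‖c₀‖ + ‖x₁‖ * ‖c₁‖)) * ∫ s in (0 : ℝ)..θ, env s := by
  have hMc : 0 ≤ Mc := (abs_nonneg _).trans (hC 0 ⟨le_rfl, hθ⟩)
  have hMs : 0 ≤ Ms := (abs_nonneg _).trans (hSn 0 ⟨le_rfl, hθ⟩)
  have hg : IntervalIntegrable (fun s : ℝ => (Mc * ‖c₀‖ + Ms * (‖x₀‖ * ‖c₀‖ + ‖x₁‖ * ‖c₁‖)) * env s) volume 0 θ :=
    (continuous_const.mul henv).intervalIntegrable _ _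
  have hpt : ∀ᵐ s : ℝ ∂volume, s ∈ Set.Ioc (0 : ℝ) θ →
      ‖((C (θ - s) : ℝ) : ℂ) * (c₀ * S₀ s) + ((Sn (θ - s) : ℝ) : ℂ) * (x₀ * (c₀ * S₀ s) + x₁ * (c₁ * S₁ s))‖ ≤
        (Mc * ‖c₀‖ + Ms * (‖x₀‖ * ‖c₀‖ + ‖x₁‖ * ‖c₁‖)) * env s := by
    refine Filter.Eventually.of_forall fun s hs => ?_
    have hts : θ - s ∈ Set.Icc (0 : ℝ) θ := ⟨by linarith [hs.2], by linarith [hs.1]⟩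
    have h0 := hE₀ s
    have h1 := hE₁ s
    have henv0 : 0 ≤ env s := (norm_nonneg _).trans h0
    refine (norm_duhamel_integrand_CSn_le _ _ _ _ _ _ _ _).trans ?_
    have hA : |C (θ - s)| * (‖c₀‖ * ‖S₀ s‖) ≤ Mc * ‖c₀‖ * env s := by
      rw [mul_assoc]
      exact mul_le_mul (hC _ hts) (mul_le_mul_of_nonneg_left h0 (norm_nonneg _)) (by positivity) hMc
    have hB : |Sn (θ - s)| * (‖x₀‖ * (‖c₀‖ * ‖S₀ s‖) + ‖x₁‖ * (‖c₁‖ * ‖S₁ s‖)) ≤ Ms * ((‖x₀‖ * ‖c₀‖ + ‖x₁‖ * ‖c₁‖) * env s) := by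
      refine mul_le_mul (hSn _ hts) ?_ (by positivity) hMs
      rw [add_mul]
      refine add_le_add ?_ ?_
      · rw [mul_assoc]; exact mul_le_mul_of_nonneg_left (mul_le_mul_of_nonneg_left h0 (norm_nonneg _)) (norm_nonneg _)
      · rw [mul_assoc]; exact mul_le_mul_of_nonneg_left (mul_le_mul_of_nonneg_left h1 (norm_nonneg _)) (norm_nonneg _)
    calc |C (θ - s)| * (‖c₀‖ * ‖S₀ s‖) + |Sn (θ - s)| * (‖x₀‖ * (‖c₀‖ * ‖S₀ s‖) + ‖x₁‖ * (‖c₁‖ * ‖S₁ s‖))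
        ≤ Mc * ‖c₀‖ * env s + Ms * ((‖x₀‖ * ‖c₀‖ + ‖x₁‖ * ‖c₁‖) * env s) := add_le_add hA hB
      _ = (Mc * ‖c₀‖ + Ms * (‖x₀‖ * ‖c₀‖ + ‖x₁‖ * ‖c₁‖)) * env s := by ring
  have h := intervalIntegral.norm_integral_le_of_norm_le hθ hpt hg
  rw [intervalIntegral.integral_const_mul] at h
  exact h

/-- **Threshold-free Duhamel bound (main term second).** [folklore] -/
theorem norm_duhamel_CSn_le' {θ Mc Ms : ℝ} {C Sn : ℝ → ℝ} {x₀ x₁ c₀ c₁ : ℂ} {S₀ S₁ : ℝ → ℂ} {env : ℝ → ℝ} (hθ : 0 ≤ θ)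
    (hC : ∀ t ∈ Set.Icc (0 : ℝ) θ, |C t| ≤ Mc) (hSn : ∀ t ∈ Set.Icc (0 : ℝ) θ, |Sn t| ≤ Ms)
    (henv : Continuous env) (hE₀ : ∀ s, ‖S₀ s‖ ≤ env s) (hE₁ : ∀ s, ‖S₁ s‖ ≤ env s) :
    ‖∫ s in (0 : ℝ)..θ, ((C (θ - s) : ℝ) : ℂ) * (c₁ * S₁ s) + ((Sn (θ - s) : ℝ) : ℂ) * (x₀ * (c₀ * S₀ s) + x₁ * (c₁ * S₁ s))‖ ≤
      (Mc * ‖c₁‖ + Ms * (‖x₁‖ * ‖c₁‖ + ‖x₀‖ * ‖c₀‖)) * ∫ s in (0 : ℝ)..θ, env s := by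
  have e : (∫ s in (0 : ℝ)..θ, ((C (θ - s) : ℝ) : ℂ) * (c₁ * S₁ s) + ((Sn (θ - s) : ℝ) : ℂ) * (x₀ * (c₀ * S₀ s) + x₁ * (c₁ * S₁ s))) =
      ∫ s in (0 : ℝ)..θ, ((C (θ - s) : ℝ) : ℂ) * (c₁ * S₁ s) + ((Sn (θ - s) : ℝ) : ℂ) * (x₁ * (c₁ * S₁ s) + x₀ * (c₀ * S₀ s)) :=
    intervalIntegral.integral_congr fun s _ => by simp only [add_comm]
  rw [e]
  exact norm_duhamel_CSn_le hθ hC hSn henv hE₁ hE₀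

/-- **With the PAIRED envelope** (`…KHModePairedSourceNeg` at a lattice mode, `u = ξ/a`): the integral is the `arctan` window,
`≤ (Mc‖c₀‖ + Ms(‖x₀‖‖c₀‖ + ‖x₁‖‖c₁‖))·N(1+θ/2)(arctan(u+θ) − arctan(u−θ))/D`. [folklore] -/
theorem norm_duhamel_CSn_paired_le {θ Mc Ms N D u : ℝ} {C Sn : ℝ → ℝ} {x₀ x₁ c₀ c₁ : ℂ} {S₀ S₁ : ℝ → ℂ} (hθ : 0 ≤ θ) (hN : 0 ≤ N) (hD : 0 < D)
    (hC : ∀ t ∈ Set.Icc (0 : ℝ) θ, |C t| ≤ Mc) (hSn : ∀ t ∈ Set.Icc (0 : ℝ) θ, |Sn t| ≤ Ms)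
    (hE₀ : ∀ s, ‖S₀ s‖ ≤ N * (1 + |s| / 2) * (1 / (1 + (u + 1 * s) ^ 2) + 1 / (1 + (u + (-1) * s) ^ 2)) / D)
    (hE₁ : ∀ s, ‖S₁ s‖ ≤ N * (1 + |s| / 2) * (1 / (1 + (u + 1 * s) ^ 2) + 1 / (1 + (u + (-1) * s) ^ 2)) / D) :
    ‖∫ s in (0 : ℝ)..θ, ((C (θ - s) : ℝ) : ℂ) * (c₀ * S₀ s) + ((Sn (θ - s) : ℝ) : ℂ) * (x₀ * (c₀ * S₀ s) + x₁ * (c₁ * S₁ s))‖ ≤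
      (Mc * ‖c₀‖ + Ms * (‖x₀‖ * ‖c₀‖ + ‖x₁‖ * ‖c₁‖)) * (N * (1 + θ / 2) * (Real.arctan (u + θ) - Real.arctan (u - θ)) / D) := by
  have hMc : 0 ≤ Mc := (abs_nonneg _).trans (hC 0 ⟨le_rfl, hθ⟩)
  have hMs : 0 ≤ Ms := (abs_nonneg _).trans (hSn 0 ⟨le_rfl, hθ⟩)
  refine (norm_duhamel_CSn_le hθ hC hSn (continuous_pairedEnv N u D) hE₀ hE₁).trans ?_
  exact mul_le_mul_of_nonneg_left (integral_pairedEnv_le hN hD hθ u) (by positivity)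

end Summit.AnomalousDissipation.AnomalousDissipation.Theorems.SawtoothPulseCascade.K2PhaseBudget

end
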